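import Summits.CriticalPhenomena.PercolationContinuityZ3.Theorems.PercNearOneGluingNoHeavyLowerTailIncStarWDOMTwoProngedTransportCore
import HarnessLib

/-!
# Mass comparison implies domination at a two-pronged root, part 2: the theorem (Sahi programme, prover prim-sahi-p2 gen 35)

Support file (`--supports stmt-CriticalPhenomena-4575`); no definitions, no named facts, no sorries; standard axioms.  Memo
`run/shared/lean/prim/prim-sahi/FROM-prim-sahi-p2-gen35-FIBRE-TRANSPORT.md` §2; part 1 (`…TwoProngedTransportCore`) is the arithmetic core.
**`twoPronged_transport`**: at a two-pronged root, `ωi·P(B_i∖B_j) + ωj·P(B_j∖B_i) ≤ cp·P(B_i∩B_j)` (weights `≥ 0`) implies the same inequality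
intersected with `{C_s ∈ 𝒜}` for every up-closed `𝒜` — `wdom_twoPronged` with free weights; on a conditioned law it is the WDOM fibre theorem.
-/

noncomputable section

namespace Summit.CriticalPhenomena.PercolationContinuityZ3.Theorems

namespace IncStar

open MeasureTheory Set Literature.Probability.Percolation Literature.Probability.LatticeModels EdgeInduction
open scoped Classical

variable {n : ℕ}

/-- **MASS COMPARISON IMPLIES DOMINATION AT A TWO-PRONGED ROOT.**  `s, i, j` distinct, every non-loop pair at `s` other than `s(s,i)`, `s(s,j)`
of weight `0` (rest arbitrary), `B_v = {s ↔ v}`, weights `cp, ωi, ωj ≥ 0` with `ωi·P(B_i ∖ B_j) + ωj·P(B_j ∖ B_i) ≤ cp·P(B_i ∩ B_j)`.  Then for every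
up-closed family `𝒜` of vertex sets, `A = {ω | C_s(ω) ∈ 𝒜}`: `ωi·P(A ∩ B_i ∖ B_j) + ωj·P(A ∩ B_j ∖ B_i) ≤ cp·P(A ∩ B_i ∩ B_j)`.  (`wdom_twoPronged` =
the instance `cp = 2 − q_i − q_j − EW`, `ωi = q_j + EW`, `ωj = q_i + EW`, mass slack `(1−a)(1−b)EW`.) [this work] -/
theorem twoPronged_transport (w : Sym2 (Fin n) → unitInterval) {s i j : Fin n} (his : i ≠ s) (hjs : j ≠ s) (hij : i ≠ j)
    (hroot : ∀ v : Fin n, v ≠ s → v ≠ i → v ≠ j → w s(s, v) = 0)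
    (cp ωi ωj : ℝ) (hcp : 0 ≤ cp) (hωi : 0 ≤ ωi) (hωj : 0 ≤ ωj)
    (hmass : ωi * ((prodBernoulli w).real (openConn s i) - (prodBernoulli w).real (openConn s i ∩ openConn s j))
        + ωj * ((prodBernoulli w).real (openConn s j) - (prodBernoulli w).real (openConn s i ∩ openConn s j))
      ≤ cp * (prodBernoulli w).real (openConn s i ∩ openConn s j))
    (𝒜 : Set (Set (Fin n))) (h𝒜 : ∀ S T : Set (Fin n), S ∈ 𝒜 → S ⊆ T → T ∈ 𝒜) :
    ωi * ((prodBernoulli w).real ({ω | openCluster ω s ∈ 𝒜} ∩ openConn s i)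
        - (prodBernoulli w).real ({ω | openCluster ω s ∈ 𝒜} ∩ openConn s i ∩ openConn s j))
      + ωj * ((prodBernoulli w).real ({ω | openCluster ω s ∈ 𝒜} ∩ openConn s j)
        - (prodBernoulli w).real ({ω | openCluster ω s ∈ 𝒜} ∩ openConn s i ∩ openConn s j))
      ≤ cp * (prodBernoulli w).real ({ω | openCluster ω s ∈ 𝒜} ∩ openConn s i ∩ openConn s j) := by
  set e₁ : Sym2 (Fin n) := s(s, i) with he₁
  set e₂ : Sym2 (Fin n) := s(s, j) with he₂
  have hne : e₁ ≠ e₂ := by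
    rw [he₁, he₂]; intro h; rw [Sym2.eq_iff] at h
    rcases h with ⟨_, h⟩ | ⟨_, h⟩
    · exact hij h
    · exact his h
  set A : Set (BondConfig (Fin n)) := {ω | openCluster ω s ∈ 𝒜} with hA
  set Bi : Set (BondConfig (Fin n)) := openConn s i with hBi
  set Bj : Set (BondConfig (Fin n)) := openConn s j with hBj
  have hAup : IsUpperSet A := isUpperSet_clusterMem s h𝒜
  by_cases hbot : ({s} : Set (Fin n)) ∈ 𝒜
  · have hAu : A = Set.univ := by
      ext ω; simp only [hA, Set.mem_setOf_eq, Set.mem_univ, iff_true]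
      exact h𝒜 _ _ hbot (by intro y hy; rw [Set.mem_singleton_iff] at hy; subst hy; exact mem_openCluster_self _ _)
    rw [hAu]
    simp only [Set.univ_inter]
    exact hmass
  set P00 := pin₂ w e₁ e₂ 0 0 with hP00
  set P01 := pin₂ w e₁ e₂ 0 1 with hP01
  set P10 := pin₂ w e₁ e₂ 1 0 with hP10
  set P11 := pin₂ w e₁ e₂ 1 1 with hP11
  haveI hI00 : IsProbabilityMeasure P00 := by rw [hP00]; unfold pin₂; infer_instance
  haveI hI01 : IsProbabilityMeasure P01 := by rw [hP01]; unfold pin₂; infer_instance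
  haveI hI10 : IsProbabilityMeasure P10 := by rw [hP10]; unfold pin₂; infer_instance
  haveI hI11 : IsProbabilityMeasure P11 := by rw [hP11]; unfold pin₂; infer_instance
  set a : ℝ := (w e₁ : ℝ) with ha
  set b : ℝ := (w e₂ : ℝ) with hb
  have ha0 : 0 ≤ a := (w e₁).2.1
  have ha1 : a ≤ 1 := (w e₁).2.2
  have hb0 : 0 ≤ b := (w e₂).2.1
  have hb1 : b ≤ 1 := (w e₂).2.2
  set D : Set (BondConfig (Fin n)) := {ω | (openGraph (ω \ {e₁, e₂})).Reachable i j} with hD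
  have hDup : IsUpperSet D := by
    intro ω ω' hle hω
    exact SimpleGraph.Reachable.mono (openGraph_mono (fun f hf => ⟨hle hf.1, hf.2⟩)) hω
  have hDins : ∀ {e : Sym2 (Fin n)}, (e = e₁ ∨ e = e₂) → ∀ ω : BondConfig (Fin n), insert e ω ∈ D ↔ ω ∈ D := by
    intro e he ω; simp only [hD, Set.mem_setOf_eq]; rw [insert_diff_rootPairs he]
  have wval := pin₂_update_apply w hne
  have other_ne : ∀ v : Fin n, v ≠ i → v ≠ j → s(s, v) ≠ e₁ ∧ s(s, v) ≠ e₂ := fun v hvi hvj => rootPair_ne_of_ne hvi hvj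
  have sure : ∀ (x y : unitInterval), (pin₂ w e₁ e₂ x y).real
      ({ω | ∀ f, Function.update (Function.update w e₁ x) e₂ y f = 1 → f ∈ ω} ∩
        {ω | ∀ f, Function.update (Function.update w e₁ x) e₂ y f = 0 → f ∉ ω}) = 1 := fun x y => real_sureSet _
  have rootfree : ∀ (x y : unitInterval) (ω : BondConfig (Fin n)),
      ω ∈ ({ω | ∀ f, Function.update (Function.update w e₁ x) e₂ y f = 1 → f ∈ ω} ∩
        {ω | ∀ f, Function.update (Function.update w e₁ x) e₂ y f = 0 → f ∉ ω} : Set (BondConfig (Fin n))) →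
      ∀ v : Fin n, v ≠ s → v ≠ i → v ≠ j → s(s, v) ∉ ω := by
    intro x y ω hω v hvs hvi hvj
    apply hω.2
    rw [wval, if_neg (other_ne v hvi hvj).2, if_neg (other_ne v hvi hvj).1]
    exact hroot v hvs hvi hvj
  have mem_one : ∀ (x : unitInterval) (ω : BondConfig (Fin n)),
      ω ∈ ({ω | ∀ f, Function.update (Function.update w e₁ x) e₂ 1 f = 1 → f ∈ ω} ∩
        {ω | ∀ f, Function.update (Function.update w e₁ x) e₂ 1 f = 0 → f ∉ ω} : Set (BondConfig (Fin n))) → e₂ ∈ ω :=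
    fun x ω hω => hω.1 e₂ (by rw [wval, if_pos rfl])
  have nmem_zero : ∀ (x : unitInterval) (ω : BondConfig (Fin n)),
      ω ∈ ({ω | ∀ f, Function.update (Function.update w e₁ x) e₂ 0 f = 1 → f ∈ ω} ∩
        {ω | ∀ f, Function.update (Function.update w e₁ x) e₂ 0 f = 0 → f ∉ ω} : Set (BondConfig (Fin n))) → e₂ ∉ ω :=
    fun x ω hω => hω.2 e₂ (by rw [wval, if_pos rfl])
  have mem_one₁ : ∀ (y : unitInterval) (ω : BondConfig (Fin n)),
      ω ∈ ({ω | ∀ f, Function.update (Function.update w e₁ 1) e₂ y f = 1 → f ∈ ω} ∩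
        {ω | ∀ f, Function.update (Function.update w e₁ 1) e₂ y f = 0 → f ∉ ω} : Set (BondConfig (Fin n))) → e₁ ∈ ω :=
    fun y ω hω => hω.1 e₁ (by rw [wval, if_neg hne, if_pos rfl])
  have nmem_zero₁ : ∀ (y : unitInterval) (ω : BondConfig (Fin n)),
      ω ∈ ({ω | ∀ f, Function.update (Function.update w e₁ 0) e₂ y f = 1 → f ∈ ω} ∩
        {ω | ∀ f, Function.update (Function.update w e₁ 0) e₂ y f = 0 → f ∉ ω} : Set (BondConfig (Fin n))) → e₁ ∉ ω :=
    fun y ω hω => hω.2 e₁ (by rw [wval, if_neg hne, if_pos rfl])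
  set G00 : Set (BondConfig (Fin n)) := {ω | ∀ f, Function.update (Function.update w e₁ 0) e₂ 0 f = 1 → f ∈ ω} ∩
    {ω | ∀ f, Function.update (Function.update w e₁ 0) e₂ 0 f = 0 → f ∉ ω} with hG00
  set G01 : Set (BondConfig (Fin n)) := {ω | ∀ f, Function.update (Function.update w e₁ 0) e₂ 1 f = 1 → f ∈ ω} ∩
    {ω | ∀ f, Function.update (Function.update w e₁ 0) e₂ 1 f = 0 → f ∉ ω} with hG01
  set G10 : Set (BondConfig (Fin n)) := {ω | ∀ f, Function.update (Function.update w e₁ 1) e₂ 0 f = 1 → f ∈ ω} ∩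
    {ω | ∀ f, Function.update (Function.update w e₁ 1) e₂ 0 f = 0 → f ∉ ω} with hG10
  set G11 : Set (BondConfig (Fin n)) := {ω | ∀ f, Function.update (Function.update w e₁ 1) e₂ 1 f = 1 → f ∈ ω} ∩
    {ω | ∀ f, Function.update (Function.update w e₁ 1) e₂ 1 f = 0 → f ∉ ω} with hG11
  have s00 : P00.real G00 = 1 := sure 0 0
  have s01 : P01.real G01 = 1 := sure 0 1
  have s10 : P10.real G10 = 1 := sure 1 0
  have s11 : P11.real G11 = 1 := sure 1 1
  have Bi_iff : ∀ ω : BondConfig (Fin n), (∀ v : Fin n, v ≠ s → v ≠ i → v ≠ j → s(s, v) ∉ ω) →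
      (ω ∈ Bi ↔ (e₁ ∈ ω) ∨ (e₂ ∈ ω ∧ ω ∈ D)) := fun ω hω => mem_openConn_left_twoPronged his hjs hω
  have Bj_iff : ∀ ω : BondConfig (Fin n), (∀ v : Fin n, v ≠ s → v ≠ i → v ≠ j → s(s, v) ∉ ω) →
      (ω ∈ Bj ↔ (e₂ ∈ ω) ∨ (e₁ ∈ ω ∧ ω ∈ D)) := fun ω hω => mem_openConn_right_twoPronged his hjs hω
  have clus_ins : ∀ {e : Sym2 (Fin n)}, (e = e₁ ∨ e = e₂) → ∀ ω : BondConfig (Fin n),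
      (∀ v : Fin n, v ≠ s → v ≠ i → v ≠ j → s(s, v) ∉ ω) → (e₁ ∈ insert e ω) → (e₂ ∈ insert e ω) → (e₁ ∈ ω ∨ e₂ ∈ ω) → ω ∈ D →
        openCluster (insert e ω) s = openCluster ω s := by
    intro e he ω hω h1' h2' hopen hωD
    have hω' : ∀ v : Fin n, v ≠ s → v ≠ i → v ≠ j → s(s, v) ∉ insert e ω := by
      intro v hvs hvi hvj habs
      rcases Set.mem_insert_iff.1 habs with h | h
      · rcases he with rfl | rfl
        · exact (other_ne v hvi hvj).1 h
        · exact (other_ne v hvi hvj).2 h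
      · exact hω v hvs hvi hvj h
    have hDω : (openGraph (ω \ {e₁, e₂})).Reachable i j := hωD
    ext y
    by_cases hys : y = s
    · subst hys; simp
    simp only [openCluster, Set.mem_setOf_eq]
    rw [reach_twoPronged (ω := insert e ω) his hjs hω' hys, reach_twoPronged (ω := ω) his hjs hω hys,
      insert_diff_rootPairs he]
    constructor
    · rintro (⟨_, hr⟩ | ⟨_, hr⟩)
      · rcases hopen with h1 | h2
        · exact Or.inl ⟨h1, hr⟩
        · exact Or.inr ⟨h2, hDω.symm.trans hr⟩
      · rcases hopen with h1 | h2
        · exact Or.inl ⟨h1, hDω.trans hr⟩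
        · exact Or.inr ⟨h2, hr⟩
    · rintro (⟨_, hr⟩ | ⟨_, hr⟩)
      · exact Or.inl ⟨h1', hr⟩
      · exact Or.inr ⟨h2', hr⟩
  have cpl₂ : ∀ X : Set (BondConfig (Fin n)), P11.real X = P10.real ((fun ω : BondConfig (Fin n) => insert e₂ ω) ⁻¹' X) :=
    fun X => by rw [hP11, hP10]; exact pin₂_real_one_one_eq_one_zero w e₁ e₂ X
  have cpl₁ : ∀ X : Set (BondConfig (Fin n)), P11.real X = P01.real ((fun ω : BondConfig (Fin n) => insert e₁ ω) ⁻¹' X) :=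
    fun X => by rw [hP11, hP01]; exact pin₂_real_one_one_eq_zero_one w hne X
  set A' := P10.real (A ∩ D) with hA'
  set X := P10.real (A \ D) with hX
  set Y := P01.real (A \ D) with hY
  set M := P11.real (A \ D) with hM
  set u := P10.real D with hu
  have hm : ∀ Z : Set (BondConfig (Fin n)), MeasurableSet Z := fun _ => MeasurableSet.of_discrete
  have splitA10 : P10.real A = A' + X := by rw [hA', hX, measureReal_inter_add_sdiff (hm D)]
  have splitA01 : P01.real A = P01.real (A ∩ D) + Y := by rw [hY, measureReal_inter_add_sdiff (hm D)]
  have splitA11 : P11.real A = P11.real (A ∩ D) + M := by rw [hM, measureReal_inter_add_sdiff (hm D)]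
  have hD11 : P11.real D = u := by
    rw [cpl₂]; congr 1; ext ω; exact hDins (Or.inr rfl) ω
  have hD01 : P01.real D = u := by
    rw [← hD11, cpl₁]; congr 1; ext ω; exact (hDins (Or.inl rfl) ω).symm
  have hAD11 : P11.real (A ∩ D) = A' := by
    rw [cpl₂, hA']
    refine real_congr_on_sure s10 fun ω hω => ?_
    simp only [Set.mem_preimage, Set.mem_inter_iff]
    rw [hDins (Or.inr rfl) ω]
    constructor
    · rintro ⟨hAi, hDm⟩
      refine ⟨?_, hDm⟩
      have hcl := clus_ins (Or.inr rfl) ω (rootfree 1 0 ω hω) (Set.mem_insert_of_mem _ (mem_one₁ 0 ω hω)) (Set.mem_insert _ _)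
        (Or.inl (mem_one₁ 0 ω hω)) hDm
      simp only [hA, Set.mem_setOf_eq] at hAi ⊢; rwa [hcl] at hAi
    · rintro ⟨hAm, hDm⟩
      refine ⟨?_, hDm⟩
      have hcl := clus_ins (Or.inr rfl) ω (rootfree 1 0 ω hω) (Set.mem_insert_of_mem _ (mem_one₁ 0 ω hω)) (Set.mem_insert _ _)
        (Or.inl (mem_one₁ 0 ω hω)) hDm
      simp only [hA, Set.mem_setOf_eq] at hAm ⊢; rwa [hcl]
  have hAD01 : P01.real (A ∩ D) = A' := by
    rw [← hAD11, cpl₁]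
    refine real_congr_on_sure s01 fun ω hω => ?_
    simp only [Set.mem_preimage, Set.mem_inter_iff]
    rw [hDins (Or.inl rfl) ω]
    constructor
    · rintro ⟨hAm, hDm⟩
      refine ⟨?_, hDm⟩
      have hcl := clus_ins (Or.inl rfl) ω (rootfree 0 1 ω hω) (Set.mem_insert _ _) (Set.mem_insert_of_mem _ (mem_one 0 ω hω))
        (Or.inr (mem_one 0 ω hω)) hDm
      simp only [hA, Set.mem_setOf_eq] at hAm ⊢; rwa [hcl]
    · rintro ⟨hAi, hDm⟩
      refine ⟨?_, hDm⟩
      have hcl := clus_ins (Or.inl rfl) ω (rootfree 0 1 ω hω) (Set.mem_insert _ _) (Set.mem_insert_of_mem _ (mem_one 0 ω hω))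
        (Or.inr (mem_one 0 ω hω)) hDm
      simp only [hA, Set.mem_setOf_eq] at hAi ⊢; rwa [hcl] at hAi
  have hMX : X ≤ M := by
    rw [hM, cpl₂, hX]
    refine measureReal_mono (fun ω hω => ?_)
    simp only [Set.mem_preimage, Set.mem_sdiff] at hω ⊢
    exact ⟨hAup (Set.subset_insert _ _) hω.1, fun h => hω.2 ((hDins (Or.inr rfl) ω).1 h)⟩
  have hMY : Y ≤ M := by
    rw [hM, cpl₁, hY]
    refine measureReal_mono (fun ω hω => ?_)
    simp only [Set.mem_preimage, Set.mem_sdiff] at hω ⊢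
    exact ⟨hAup (Set.subset_insert _ _) hω.1, fun h => hω.2 ((hDins (Or.inl rfl) ω).1 h)⟩
  have hHar10 : P10.real A * P10.real D ≤ P10.real (A ∩ D) := prodBernoulli_harris _ hAup hDup (hm A) (hm D)
  have hHar01 : P01.real A * P01.real D ≤ P01.real (A ∩ D) := prodBernoulli_harris _ hAup hDup (hm A) (hm D)
  rw [splitA10] at hHar10
  rw [splitA01, hAD01, hD01] at hHar01
  have hH1 : u * X ≤ (1 - u) * A' := by nlinarith [hHar10]
  have hH2 : u * Y ≤ (1 - u) * A' := by nlinarith [hHar01]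
  have v10_1 : P10.real (A ∩ Bi ∩ Bj) = A' := by
    rw [hA']; refine real_congr_on_sure s10 fun ω hω => ?_
    simp only [Set.mem_inter_iff]
    rw [Bi_iff ω (rootfree 1 0 ω hω), Bj_iff ω (rootfree 1 0 ω hω)]
    have h1 := mem_one₁ 0 ω hω; have h2 := nmem_zero 1 ω hω
    constructor
    · rintro ⟨⟨hA, _⟩, hB⟩
      rcases hB with h | ⟨_, hd⟩
      · exact absurd h h2
      · exact ⟨hA, hd⟩
    · rintro ⟨hA, hd⟩; exact ⟨⟨hA, Or.inl h1⟩, Or.inr ⟨h1, hd⟩⟩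
  have v10_2 : P10.real (A ∩ Bi) = A' + X := by
    rw [← splitA10]; refine real_congr_on_sure s10 fun ω hω => ?_
    simp only [Set.mem_inter_iff]
    rw [Bi_iff ω (rootfree 1 0 ω hω)]
    exact ⟨fun h => h.1, fun h => ⟨h, Or.inl (mem_one₁ 0 ω hω)⟩⟩
  have v10_3 : P10.real (A ∩ Bj) = A' := by
    rw [hA']; refine real_congr_on_sure s10 fun ω hω => ?_
    simp only [Set.mem_inter_iff]
    rw [Bj_iff ω (rootfree 1 0 ω hω)]
    have h1 := mem_one₁ 0 ω hω; have h2 := nmem_zero 1 ω hω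
    constructor
    · rintro ⟨hA, hB⟩
      rcases hB with h | ⟨_, hd⟩
      · exact absurd h h2
      · exact ⟨hA, hd⟩
    · rintro ⟨hA, hd⟩; exact ⟨hA, Or.inr ⟨h1, hd⟩⟩
  have v10_5 : P10.real Bi = 1 := by
    rw [← probReal_univ (μ := P10)]
    refine real_congr_on_sure s10 fun ω hω => ?_
    simp only [Set.mem_univ, iff_true]
    rw [Bi_iff ω (rootfree 1 0 ω hω)]; exact Or.inl (mem_one₁ 0 ω hω)
  have v10_6 : P10.real Bj = u := by
    rw [hu]; refine real_congr_on_sure s10 fun ω hω => ?_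
    rw [Bj_iff ω (rootfree 1 0 ω hω)]
    have h1 := mem_one₁ 0 ω hω; have h2 := nmem_zero 1 ω hω
    constructor
    · rintro (h | ⟨_, hd⟩)
      · exact absurd h h2
      · exact hd
    · intro hd; exact Or.inr ⟨h1, hd⟩
  have v10_7 : P10.real (Bi ∩ Bj) = u := by
    rw [hu]; refine real_congr_on_sure s10 fun ω hω => ?_
    simp only [Set.mem_inter_iff]
    rw [Bi_iff ω (rootfree 1 0 ω hω), Bj_iff ω (rootfree 1 0 ω hω)]
    have h1 := mem_one₁ 0 ω hω; have h2 := nmem_zero 1 ω hω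
    constructor
    · rintro ⟨_, hB⟩
      rcases hB with h | ⟨_, hd⟩
      · exact absurd h h2
      · exact hd
    · intro hd; exact ⟨Or.inl h1, Or.inr ⟨h1, hd⟩⟩
  have v01_1 : P01.real (A ∩ Bi ∩ Bj) = A' := by
    rw [← hAD01]; refine real_congr_on_sure s01 fun ω hω => ?_
    simp only [Set.mem_inter_iff]
    rw [Bi_iff ω (rootfree 0 1 ω hω), Bj_iff ω (rootfree 0 1 ω hω)]
    have h1 := nmem_zero₁ 1 ω hω; have h2 := mem_one 0 ω hω
    constructor
    · rintro ⟨⟨hA, hB⟩, _⟩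
      rcases hB with h | ⟨_, hd⟩
      · exact absurd h h1
      · exact ⟨hA, hd⟩
    · rintro ⟨hA, hd⟩; exact ⟨⟨hA, Or.inr ⟨h2, hd⟩⟩, Or.inl h2⟩
  have v01_2 : P01.real (A ∩ Bi) = A' := by
    rw [← hAD01]; refine real_congr_on_sure s01 fun ω hω => ?_
    simp only [Set.mem_inter_iff]
    rw [Bi_iff ω (rootfree 0 1 ω hω)]
    have h1 := nmem_zero₁ 1 ω hω; have h2 := mem_one 0 ω hω
    constructor
    · rintro ⟨hA, hB⟩
      rcases hB with h | ⟨_, hd⟩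
      · exact absurd h h1
      · exact ⟨hA, hd⟩
    · rintro ⟨hA, hd⟩; exact ⟨hA, Or.inr ⟨h2, hd⟩⟩
  have v01_3 : P01.real (A ∩ Bj) = A' + Y := by
    rw [← hAD01, ← splitA01]; refine real_congr_on_sure s01 fun ω hω => ?_
    simp only [Set.mem_inter_iff]
    rw [Bj_iff ω (rootfree 0 1 ω hω)]
    exact ⟨fun h => h.1, fun h => ⟨h, Or.inl (mem_one 0 ω hω)⟩⟩
  have v01_5 : P01.real Bi = u := by
    rw [← hD01]; refine real_congr_on_sure s01 fun ω hω => ?_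
    rw [Bi_iff ω (rootfree 0 1 ω hω)]
    have h1 := nmem_zero₁ 1 ω hω; have h2 := mem_one 0 ω hω
    constructor
    · rintro (h | ⟨_, hd⟩)
      · exact absurd h h1
      · exact hd
    · intro hd; exact Or.inr ⟨h2, hd⟩
  have v01_6 : P01.real Bj = 1 := by
    rw [← probReal_univ (μ := P01)]
    refine real_congr_on_sure s01 fun ω hω => ?_
    simp only [Set.mem_univ, iff_true]
    rw [Bj_iff ω (rootfree 0 1 ω hω)]; exact Or.inl (mem_one 0 ω hω)
  have v01_7 : P01.real (Bi ∩ Bj) = u := by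
    rw [← hD01]; refine real_congr_on_sure s01 fun ω hω => ?_
    simp only [Set.mem_inter_iff]
    rw [Bi_iff ω (rootfree 0 1 ω hω), Bj_iff ω (rootfree 0 1 ω hω)]
    have h1 := nmem_zero₁ 1 ω hω; have h2 := mem_one 0 ω hω
    constructor
    · rintro ⟨hB, _⟩
      rcases hB with h | ⟨_, hd⟩
      · exact absurd h h1
      · exact hd
    · intro hd; exact ⟨Or.inr ⟨h2, hd⟩, Or.inl h2⟩
  have v11_B : ∀ ω ∈ G11, ω ∈ Bi ∧ ω ∈ Bj := by
    intro ω hω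
    rw [Bi_iff ω (rootfree 1 1 ω hω), Bj_iff ω (rootfree 1 1 ω hω)]
    exact ⟨Or.inl (mem_one₁ 1 ω hω), Or.inl (mem_one 1 ω hω)⟩
  have v11_1 : P11.real (A ∩ Bi ∩ Bj) = A' + M := by
    rw [← hAD11, ← splitA11]; refine real_congr_on_sure s11 fun ω hω => ?_
    simp only [Set.mem_inter_iff]
    exact ⟨fun h => h.1.1, fun h => ⟨⟨h, (v11_B ω hω).1⟩, (v11_B ω hω).2⟩⟩
  have v11_2 : P11.real (A ∩ Bi) = A' + M := by
    rw [← hAD11, ← splitA11]; refine real_congr_on_sure s11 fun ω hω => ?_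
    simp only [Set.mem_inter_iff]
    exact ⟨fun h => h.1, fun h => ⟨h, (v11_B ω hω).1⟩⟩
  have v11_3 : P11.real (A ∩ Bj) = A' + M := by
    rw [← hAD11, ← splitA11]; refine real_congr_on_sure s11 fun ω hω => ?_
    simp only [Set.mem_inter_iff]
    exact ⟨fun h => h.1, fun h => ⟨h, (v11_B ω hω).2⟩⟩
  have v11_5 : P11.real Bi = 1 := by
    rw [← probReal_univ (μ := P11)]
    refine real_congr_on_sure s11 fun ω hω => ?_
    simp only [Set.mem_univ, iff_true]; exact (v11_B ω hω).1
  have v11_6 : P11.real Bj = 1 := by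
    rw [← probReal_univ (μ := P11)]
    refine real_congr_on_sure s11 fun ω hω => ?_
    simp only [Set.mem_univ, iff_true]; exact (v11_B ω hω).2
  have v11_7 : P11.real (Bi ∩ Bj) = 1 := by
    rw [← probReal_univ (μ := P11)]
    refine real_congr_on_sure s11 fun ω hω => ?_
    simp only [Set.mem_inter_iff, Set.mem_univ, iff_true]; exact v11_B ω hω
  have v00_B : ∀ ω ∈ G00, ω ∉ Bi ∧ ω ∉ Bj := by
    intro ω hω
    rw [Bi_iff ω (rootfree 0 0 ω hω), Bj_iff ω (rootfree 0 0 ω hω)]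
    have h1 := nmem_zero₁ 0 ω hω; have h2 := nmem_zero 0 ω hω
    exact ⟨fun h => h.elim h1 (fun h' => h2 h'.1), fun h => h.elim h2 (fun h' => h1 h'.1)⟩
  have zero00 : ∀ Z : Set (BondConfig (Fin n)), (∀ ω ∈ G00, ω ∉ Z) → P00.real Z = 0 := by
    intro Z hZ
    have h0 : P00.real (∅ : Set (BondConfig (Fin n))) = 0 := by simp
    rw [← h0]
    refine real_congr_on_sure s00 fun ω hω => ?_
    simp only [Set.mem_empty_iff_false, iff_false]; exact hZ ω hω
  have v00_1 : P00.real (A ∩ Bi ∩ Bj) = 0 := zero00 _ fun ω hω h => (v00_B ω hω).1 h.1.2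
  have v00_2 : P00.real (A ∩ Bi) = 0 := zero00 _ fun ω hω h => (v00_B ω hω).1 h.2
  have v00_3 : P00.real (A ∩ Bj) = 0 := zero00 _ fun ω hω h => (v00_B ω hω).2 h.2
  have v00_5 : P00.real Bi = 0 := zero00 _ fun ω hω h => (v00_B ω hω).1 h
  have v00_6 : P00.real Bj = 0 := zero00 _ fun ω hω h => (v00_B ω hω).2 h
  have v00_7 : P00.real (Bi ∩ Bj) = 0 := zero00 _ fun ω hω h => (v00_B ω hω).1 h.1
  have hA'0 : 0 ≤ A' := measureReal_nonneg
  have hX0 : 0 ≤ X := measureReal_nonneg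
  have hY0 : 0 ≤ Y := measureReal_nonneg
  have hu0 : 0 ≤ u := measureReal_nonneg
  have hu1 : u ≤ 1 := measureReal_le_one
  rw [real_twoBondDecomp w hne Bi, real_twoBondDecomp w hne Bj, real_twoBondDecomp w hne (Bi ∩ Bj)] at hmass
  simp only [← ha, ← hb] at hmass
  rw [v00_5, v00_6, v00_7, v01_5, v01_6, v01_7, v10_5, v10_6, v10_7, v11_5, v11_6, v11_7] at hmass
  rw [real_twoBondDecomp w hne (A ∩ Bi ∩ Bj), real_twoBondDecomp w hne (A ∩ Bi), real_twoBondDecomp w hne (A ∩ Bj)]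
  simp only [← ha, ← hb]
  rw [v00_1, v00_2, v00_3, v01_1, v01_2, v01_3, v10_1, v10_2, v10_3, v11_1, v11_2, v11_3]
  have hDi0 : 0 ≤ a * (1 - b) * ωi := mul_nonneg (mul_nonneg ha0 (by linarith)) hωi
  have hDj0 : 0 ≤ (1 - a) * b * ωj := mul_nonneg (mul_nonneg (by linarith) hb0) hωj
  have hmass' : (1 - u) * (a * (1 - b) * ωi + (1 - a) * b * ωj) ≤ cp * (a + b - a * b) * u + a * b * cp * (1 - u) := by
    have hr : cp * (a + b - a * b) * u + a * b * cp * (1 - u) - (1 - u) * (a * (1 - b) * ωi + (1 - a) * b * ωj)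
        = cp * ((1 - a) * (1 - b) * 0 + (1 - a) * b * u + a * (1 - b) * u + a * b * 1)
          - (ωi * ((1 - a) * (1 - b) * 0 + (1 - a) * b * u + a * (1 - b) * 1 + a * b * 1
              - ((1 - a) * (1 - b) * 0 + (1 - a) * b * u + a * (1 - b) * u + a * b * 1))
            + ωj * ((1 - a) * (1 - b) * 0 + (1 - a) * b * 1 + a * (1 - b) * u + a * b * 1
              - ((1 - a) * (1 - b) * 0 + (1 - a) * b * u + a * (1 - b) * u + a * b * 1))) := by ring
    linarith [hmass, hr]
  have core := twoPronged_transport_core a b u A' X Y M cp (a * (1 - b) * ωi) ((1 - a) * b * ωj)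
    ha0 hb0 hb1 hu1 hcp hDi0 hDj0 hA'0 hX0 hY0 hH1 hH2 hMX hMY hmass'
  have hr2 : cp * ((1 - a) * (1 - b) * 0 + (1 - a) * b * A' + a * (1 - b) * A' + a * b * (A' + M))
      - (ωi * ((1 - a) * (1 - b) * 0 + (1 - a) * b * A' + a * (1 - b) * (A' + X) + a * b * (A' + M)
          - ((1 - a) * (1 - b) * 0 + (1 - a) * b * A' + a * (1 - b) * A' + a * b * (A' + M)))
        + ωj * ((1 - a) * (1 - b) * 0 + (1 - a) * b * (A' + Y) + a * (1 - b) * A' + a * b * (A' + M)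
          - ((1 - a) * (1 - b) * 0 + (1 - a) * b * A' + a * (1 - b) * A' + a * b * (A' + M))))
      = cp * (a + b - a * b) * A' + a * b * cp * M - a * (1 - b) * ωi * X - (1 - a) * b * ωj * Y := by ring
  linarith [core, hr2]

end IncStar
end Summit.CriticalPhenomena.PercolationContinuityZ3.Theorems
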